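import Mathlib
import Summits.CriticalPhenomena.Ising3DConformalLimit.Theses.GaussianScaleMixture
import Summits.CriticalPhenomena.Ising3DConformalLimit.Theorems.GSMRigidity.Negative.ThreeAtomKernel
-- import Summits.CriticalPhenomena.Ising3DConformalLimit.Theorems.GSMRigidity.Negative.TwoRowSwapRP
--   ^ landed p76142 (triage r1-3: `twoRow_expConvex` + a two-row certificate against the witness); the farm reports the
--     module `stale:unbuilt` at publication time, so its entry lemma is RE-PROVED below verbatim (`twoRow_expConvex`).
-- import Literature.Analysis.OperatorTheory.HalfLinePositiveDefinite
--   ^ `IsBoundedHalfLinePD.exists_laplace_repr` (bounded positive-definite functions on ((0,∞),+) are Laplace transforms,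
--     PROVED in the tree) is the intended input of `stub_halfPlaneExtension`; module `stale:unbuilt` on the farm at
--     publication time, hence `BoundedExpConvex` below repeats `IsBoundedHalfLinePD` field for field.
import Literature.MathematicalPhysics.QuantumFieldTheory.LatticeMirrorNormals
import Literature.MathematicalPhysics.QuantumFieldTheory.MirrorRPKernel

/-!
# Line `tilted-lightcone-jump-positivity` — checked skeleton for crux `GaussianScaleMixture.GSMRigidity`

Crux (item stmt-CriticalPhenomena-8366, route GaussianScaleMixture, rank 3; decl
`Summit.CriticalPhenomena.Ising3DConformalLimit.Theses.GaussianScaleMixture.GSMRigidity`, FIXED): a continuous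
positive kernel `K` on `ℝ³∖{0}`, homogeneous of degree `-2Δ` (`1/2 ≤ Δ ≤ 1`), invariant and reflection positive
for the nine `B₃` mirror normals `eᵢ, eᵢ ± eⱼ`, which is moreover a Gaussian scale mixture off the origin
(`K x = ∫ exp(-Σ sᵢxᵢ²) dν(s)`, `ν` on the closed octant), is invariant under every linear isometry.

IDEA (crux card `Ideas/tilted-lightcone-jump-positivity.md`, triage r1: pass, pass, pass). Work in POSITION
space on the swap plane `x₂ = 0` of the diagonal mirror `x₀ = x₁`: rows `T(1,-1,0)` (on the mirror-time axis)
and `T(1,-1,0) + ξ(1,1,0)` (transverse offset `ξ = ±1`). Two-row reflection positivity makes `k₀ ± g`,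
`k₀(T) = K(T,-T,0)`, `g(T) = K(T+ξ, ξ-T, 0)`, positive-definite kernels of `t_a + t_b` on `(0,∞)`
(`twoRow_expConvex`, kernel-checked), so by Bernstein–Widder `g` continues holomorphically to complex mirror
time `Re T > 0` (S2). In polar form `K = ∫ (ω·x²)^(-Δ) dΦ(ω)` (S1) every component has the swap-plane section
`ω₀(T+ξ)² + ω₁(T-ξ)² = (ω₀+ω₁)·T·(T + 1/T - c_ω)` — the MAGIC CIRCLE: in the Joukowski variable
`w = T + 1/T` each component is `(w - c_ω)^(-Δ)` with its branch point at `c_ω = 2ξ(ω₁-ω₀)/(ω₀+ω₁) ∈ (-2,2)`,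
i.e. ON THE ONE CIRCLE `|T| = 1` at the angle of its tilted light cone (`magic_circle`, `sliceMeasure_section`,
kernel-checked). So `T^Δ g(T) = S(T + 1/T)` with `S(w) = ∫ (w-c)^(-Δ) dρ(c)` an order-`Δ` Stieltjes transform
of the finite positive ANISOTROPY MEASURE `ρ = (c_ω)_*((ω₀+ω₁)^(-Δ)Φ)` on `[-2,2]`. Holomorphy of `g` on
`Re T > 0` forces `S` to take equal boundary values on both sides of the slit `(0,2) = w(arc)`; but EVERY term
`Im (w₀ + iδ - c)^(-Δ)` is `≤ 0`, and for `c > w₀` tends to `-(c-w₀)^(-Δ) sin(πΔ)`: a one-signed (Volterra-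
triangular AND positive) jump, so `ρ((0,2)) = 0` (S3, `0 < Δ < 1`, Fatou; S4, `Δ = 1`, Stieltjes–Perron /
log-potential jump). Pulled back (`sliceMeasure_pull`, kernel-checked): `Φ{ξ(ω₀-ω₁) < 0} = 0`; both signs of
`ξ` and the permutation symmetry of `Φ` give `ω₀ = ω₁ = ω₂` `Φ`-a.e., whence `K` is a function of `‖x‖`
(`isometryInvariant_of_diagonal`, kernel-checked).

SKELETON (4 registered stubs + the kernel-checked composition `GSMRigidity_of`):
* `stub_polarForm`          — S1 DICTIONARY (measure side): GSM + homogeneity + permutation invariance ⇒ a finite,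
                                permutation-symmetric polar measure `Φ` on the open octant with
                                `K x = ∫ (Σ ωᵢxᵢ²)^(-Δ) dΦ` (`IsPolarGSM`). Laplace uniqueness on the octant
                                (dilation covariance of `ν`) + one Tonelli computation. Size L.
* `stub_halfPlaneExtension` — S2 DICTIONARY (analytic side): a positive-definite function on the semigroup
                                `((0,∞),+)`, bounded on every `[t₀,∞)` (and continuous), is the restriction of a
                                function holomorphic on `Re z > 0` (Bernstein–Widder; in the tree:
                                `IsBoundedHalfLinePD.exists_laplace_repr`). RP is consumed HERE. Size M.
* `stub_sliceNoMass_lt_one` — S3 THE LEVER (`0 < Δ < 1`): an order-`Δ` Stieltjes transform of a finite positive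
                                measure on `[-2,2]` whose Joukowski pull-back is holomorphic on the right
                                half-plane charges nothing in `(0,2)` (`SliceNoMass Δ`). Size L. HARDEST.
* `stub_sliceNoMass_one`    — S4 THE ENDPOINT `Δ = 1` (`SliceNoMass 1`): Cauchy–Stieltjes transform,
                                Stieltjes–Perron inversion / log-potential jump. Size M–L.
Kernel-checked (sorry-free): the two-row algebra (`twoRow_expConvex`), evenness from the coordinate mirrors,
boundedness of `K` off balls (`cruxHyp_bound`), the whole Joukowski dictionary (`magic_circle`,
`sliceMeasure_finite/support/section/pull`), the symmetry transport (`null12_of_null01`, `ae_diagonal`), the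
round endgame (`isometryInvariant_of_diagonal`) and the composition `GSMRigidity_of : GSMRigidity` (case split
`Δ < 1` / `Δ = 1`); sorries ONLY in `stub_*`. Hypotheses of the crux actually used: GSM, homogeneity,
continuity, the swap mirror `x₀ = x₁` (invariance + RP, two rows), the three coordinate mirrors (evenness), the
two other swap mirrors (permutation invariance), `0 < Δ ≤ 1`. NOT used: positivity of `K`, `Δ ≥ 1/2`, the
anti-diagonal mirrors, configurations with `≥ 3` rows — consistent with Disproof F4/F9(iii).

DISPROOF USED (`Cruxes/GSMRigidity/Disproof.lean` v3.1, cycles 1–2: NO KILL, crux judged TRUE (F3/F8); landed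
`Theorems/GSMRigidity/Negative/{ThreeAtomKernel,SwapPencilJump,PlannerFamily,TwoRowSwapRP}.lean`):
`gsmRigidity_false_without_RP` / `not_gsmRigidity_without_RP` — honoured: RP enters at `section_holomorphic`
(two-row swap-RP ⇒ `BoundedExpConvex` ⇒ S2); the witness `threeAtomKernel` has a section pole at
`T₀ = (1+2√2 i)/3`, `|T₀| = 1`, `Re T₀ > 0` (TwoRowSwapRP), so S2's conclusion fails for it exactly as it must
(`threeAtomKernel_not_twoRow_posdef`). `swapSlice_factor` (circle lemma, k-side) = `magic_circle` (x-side);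
`arcBase_eq` + `jump_positivity` (one phase, positive jump) = the sign structure inside S3; `SliceRigidity p` /
`SwapPencilAnalytic` = the k-side twins of `SliceNoMass Δ` / `section_holomorphic` (exponent `Δ` here instead
of `p = 3/2 - Δ`; the endpoint needing a separate argument is `Δ = 1` here, `Δ = 1/2` there). F9(iii) (one
swap + `B₃`-invariance suffices) = `null12_of_null01`. No stub is an instance of a landed Negative lemma: S1 and
S2 do not conclude isotropy, S3/S4 are one-variable statements; the in-cone non-RP witnesses
(`threeAtomKernel`, `plannerKernel ε`) have `ρ((0,2)) > 0` for one sign of `ξ` and are caught, not assumed away.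
-/

noncomputable section

open scoped BigOperators InnerProductSpace
open MeasureTheory Set
open Literature.MathematicalPhysics.QuantumFieldTheory
open Summit.CriticalPhenomena.Ising3DConformalLimit.Theorems.GSMRigidity.Negative
  (mk nSwap inner_mk_nSwap reflection_nSwap_mk mk_sub_mk mk_apply_zero mk_apply_one mk_apply_two)

namespace Summit.CriticalPhenomena.Ising3DConformalLimit.Cruxes.GSMRigidity.TiltedLightconeJumpPositivity

/-! ## Vocabulary -/

/-- `ℝ³`. -/
abbrev E3 := EuclideanSpace ℝ (Fin 3)

/-- The nine-normal shape predicate, verbatim from the crux. -/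
def NineNormal (n : E3) : Prop :=
  ∃ i j : Fin 3, i ≠ j ∧ (n = EuclideanSpace.single i 1 ∨
    n = EuclideanSpace.single i 1 + EuclideanSpace.single j 1 ∨
    n = EuclideanSpace.single i 1 - EuclideanSpace.single j 1)

/-- The hypotheses of the crux on `(Δ, K)`, bundled verbatim (the RP conjunct of `nine` is
`IsMirrorRPKernel n K` by `Iff.rfl`; `gsm` is the Gaussian-scale-mixture conjunct). -/
structure CruxHyp (Δ : ℝ) (K : E3 → ℝ) : Prop where
  half_le : 1/2 ≤ Δ
  le_one : Δ ≤ 1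
  continuousOn : ContinuousOn K {0}ᶜ
  pos : ∀ x, x ≠ 0 → 0 < K x
  homogeneous : ∀ c : ℝ, 0 < c → ∀ x, K (c • x) = c ^ (-(2 * Δ)) * K x
  nine : ∀ n : E3, NineNormal n →
    (∀ x, K (((ℝ ∙ n)ᗮ).reflection x) = K x) ∧
    (∀ (m : ℕ) (p : Fin m → E3) (c : Fin m → ℝ), (∀ a, 0 < inner ℝ (p a) n) →
      0 ≤ ∑ a, ∑ b, c a * c b * K (p a - ((ℝ ∙ n)ᗮ).reflection (p b)))
  gsm : ∃ ν : Measure (Fin 3 → ℝ), ν {s | ∃ i, s i < 0} = 0 ∧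
    ∀ x : E3, x ≠ 0 → Integrable (fun s => Real.exp (-∑ i, s i * (x i) ^ 2)) ν ∧
      K x = ∫ s, Real.exp (-∑ i, s i * (x i) ^ 2) ∂ν

/-- **Polar (simplex) form of a homogeneous Gaussian scale mixture** (output of S1): a FINITE measure `Φ`
carried by the OPEN octant, symmetric under the coordinate permutations, with
`K x = ∫ (Σᵢ ωᵢ xᵢ²)^(-Δ) dΦ(ω)` and the integrand integrable at every `x ≠ 0` (the factor `Γ(Δ)` of the
radial integration is absorbed into `Φ`; `Φ` need NOT live on the simplex — any finite measure on the open
cone with the right radial projection will do, see the docstring of `stub_polarForm`). -/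
structure IsPolarGSM (Δ : ℝ) (K : E3 → ℝ) (Φ : Measure (Fin 3 → ℝ)) : Prop where
  finite : IsFiniteMeasure Φ
  octant : Φ {ω | ∃ i, ω i ≤ 0} = 0
  symm : ∀ σ : Equiv.Perm (Fin 3), Φ.map (fun ω => ω ∘ σ) = Φ
  integrable : ∀ x : E3, x ≠ 0 → Integrable (fun ω => (∑ i, ω i * (x i) ^ 2) ^ (-Δ)) Φ
  repr : ∀ x : E3, x ≠ 0 → K x = ∫ ω, (∑ i, ω i * (x i) ^ 2) ^ (-Δ) ∂Φ

/-- **Bounded positive-definite function on the semigroup `((0,∞),+)`** — field for field the tree's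
`Literature.Analysis.OperatorTheory.IsBoundedHalfLinePD` (module unbuilt on the farm at publication time;
swap in the import once built): `(s,t) ↦ f (s+t)` is a positive semi-definite kernel on `(0,∞)` (Bernstein's
"exponential convexity" in finite-point form) and `f` is bounded on every `[t₀,∞)`, `t₀ > 0`. -/
structure BoundedExpConvex (f : ℝ → ℝ) : Prop where
  posDef : ∀ (m : ℕ) (s : Fin m → ℝ) (c : Fin m → ℝ), (∀ a, 0 < s a) →
    0 ≤ ∑ a, ∑ b, c a * c b * f (s a + s b)
  bdd : ∀ t₀ : ℝ, 0 < t₀ → ∃ M : ℝ, ∀ t : ℝ, t₀ ≤ t → |f t| ≤ M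

/-- The open right half-plane `Re z > 0` (complex swap-mirror time). -/
def rightHalfPlane : Set ℂ := {z : ℂ | 0 < z.re}

/-- `f : (0,∞) → ℝ` is the restriction of a function holomorphic on the open right half-plane. -/
def HasHolomorphicExtension (f : ℝ → ℝ) : Prop :=
  ∃ F : ℂ → ℂ, DifferentiableOn ℂ F rightHalfPlane ∧ ∀ t : ℝ, 0 < t → F (t : ℂ) = ((f t : ℝ) : ℂ)

/-- The BRANCH-POINT COORDINATE of the component `ω` for the pair `(0,1)` and offset sign `ξ = ±1`:
`c_ω = 2ξ(ω₁ - ω₀)/(ω₀ + ω₁) ∈ (-2, 2)` on the open octant — the position `2 cos χ_ω` on the slit of the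
branch point `e^{iχ_ω}` of the component's swap-plane section (the angle of its tilted light cone in
Wick-rotated mirror time); `c_ω = 0` iff `ω₀ = ω₁`, and `c_ω ∈ (0,2)` iff `ξ(ω₀ - ω₁) < 0`. -/
def cCoord (ξ : ℝ) (ω : Fin 3 → ℝ) : ℝ := 2 * ξ * (ω 1 - ω 0) / (ω 0 + ω 1)

/-- The ANISOTROPY MEASURE on the slit `[-2,2]`: push-forward of `(ω₀+ω₁)^(-Δ) Φ` by `cCoord ξ`. -/
def sliceMeasure (Δ ξ : ℝ) (Φ : Measure (Fin 3 → ℝ)) : Measure ℝ :=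
  (Φ.withDensity fun ω => ENNReal.ofReal ((ω 0 + ω 1) ^ (-Δ))).map (cCoord ξ)

/-- The JOUKOWSKI PULL-BACK of the order-`Δ` Stieltjes transform `S(w) = ∫ (w - c)^(-Δ) dρ(c)` of a
measure `ρ` on the slit: `T ↦ S(T + 1/T)` for `T > 0` (there `T + 1/T ≥ 2 ≥ c`, real powers suffice). -/
def joukStieltjes (Δ : ℝ) (ρ : Measure ℝ) (T : ℝ) : ℝ := ∫ c, (T + T⁻¹ - c) ^ (-Δ) ∂ρ

/-- **Slice rigidity at order `Δ`** (the lever; one complex variable, no physics): a finite positive measure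
`ρ` on `[-2,2]` whose Joukowski-pulled-back order-`Δ` Stieltjes transform agrees on `(0,1) ∪ (1,∞)` with a
function holomorphic on the open right half-plane charges nothing in the open slit `(0,2)` (= the image
`2 cos θ` of the open arc `e^{iθ}`, `0 < θ < π/2`, of the unit circle, where the inside and outside
continuations must agree). -/
def SliceNoMass (Δ : ℝ) : Prop :=
  ∀ ρ : Measure ℝ, IsFiniteMeasure ρ → ρ (Icc (-2) 2)ᶜ = 0 →
    (∃ F : ℂ → ℂ, DifferentiableOn ℂ F rightHalfPlane ∧
      ∀ T : ℝ, 0 < T → T ≠ 1 → F (T : ℂ) = ((joukStieltjes Δ ρ T : ℝ) : ℂ)) →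
    ρ (Ioo 0 2) = 0

/-! ## Kernel-checked lemmas (sorry-free) -/

/-! ### The crux hypotheses: nine normals, evenness, the swap mirror -/

theorem nineNormal_single {i j : Fin 3} (hij : i ≠ j) :
    NineNormal (EuclideanSpace.single i 1) := ⟨i, j, hij, Or.inl rfl⟩

theorem nineNormal_nSwap : NineNormal nSwap := ⟨0, 1, by decide, Or.inr (Or.inr rfl)⟩

theorem neg_eq_three_reflections (x : E3) :
    -x = (ℝ ∙ EuclideanSpace.single (0 : Fin 3) (1 : ℝ))ᗮ.reflection
          ((ℝ ∙ EuclideanSpace.single (1 : Fin 3) (1 : ℝ))ᗮ.reflection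
            ((ℝ ∙ EuclideanSpace.single (2 : Fin 3) (1 : ℝ))ᗮ.reflection x)) := by
  ext l
  fin_cases l <;> simp [reflection_single_apply]

/-- The three coordinate mirrors compose to `-id`: a nine-mirror-invariant kernel is even. -/
theorem even_of_cruxHyp {Δ : ℝ} {K : E3 → ℝ} (h : CruxHyp Δ K) (x : E3) : K (-x) = K x := by
  rw [neg_eq_three_reflections x,
    (h.nine _ (nineNormal_single (show (0 : Fin 3) ≠ 1 by decide))).1,
    (h.nine _ (nineNormal_single (show (1 : Fin 3) ≠ 0 by decide))).1,
    (h.nine _ (nineNormal_single (show (2 : Fin 3) ≠ 0 by decide))).1]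

/-- Swap reflection positivity, finite-point form (`Iff.rfl` with the crux conjunct). -/
theorem swapRP_of_cruxHyp {Δ : ℝ} {K : E3 → ℝ} (h : CruxHyp Δ K) : IsMirrorRPKernel nSwap K :=
  (h.nine nSwap nineNormal_nSwap).2

theorem swapInv_of_cruxHyp {Δ : ℝ} {K : E3 → ℝ} (h : CruxHyp Δ K) (x : E3) :
    K ((ℝ ∙ nSwap)ᗮ.reflection x) = K x :=
  (h.nine nSwap nineNormal_nSwap).1 x

/-! ### Two-row swap reflection positivity (= `Negative/TwoRowSwapRP.lean`, re-proved until that module is built) -/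

theorem neg_mk_eq (a b : ℝ) : -mk a b = mk (-a) (-b) := by
  ext l
  fin_cases l <;> simp [mk]

theorem twoRow_pt11 (s r : ℝ) :
    mk s (-s) - (ℝ ∙ nSwap)ᗮ.reflection (mk r (-r)) = mk (s + r) (-(s + r)) := by
  rw [reflection_nSwap_mk, mk_sub_mk]
  congr 1 <;> ring

theorem twoRow_pt12 (s r ξ : ℝ) :
    mk s (-s) - (ℝ ∙ nSwap)ᗮ.reflection (mk (r + ξ) (ξ - r)) = mk ((s + r) - ξ) (-(s + r) - ξ) := by
  rw [reflection_nSwap_mk, mk_sub_mk]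
  congr 1 <;> ring

theorem twoRow_pt21 (s r ξ : ℝ) :
    mk (s + ξ) (ξ - s) - (ℝ ∙ nSwap)ᗮ.reflection (mk r (-r)) = mk ((s + r) + ξ) (ξ - (s + r)) := by
  rw [reflection_nSwap_mk, mk_sub_mk]
  congr 1 <;> ring

theorem twoRow_pt22 (s r ξ : ℝ) :
    mk (s + ξ) (ξ - s) - (ℝ ∙ nSwap)ᗮ.reflection (mk (r + ξ) (ξ - r)) = mk (s + r) (-(s + r)) := by
  rw [reflection_nSwap_mk, mk_sub_mk]
  congr 1 <;> ring

theorem twoRow_cross_symm {K : E3 → ℝ} (heven : ∀ x, K (-x) = K x)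
    (hswap : ∀ x, K ((ℝ ∙ nSwap)ᗮ.reflection x) = K x) (s ξ : ℝ) :
    K (mk (s - ξ) (-s - ξ)) = K (mk (s + ξ) (ξ - s)) := by
  have h1 : mk (s - ξ) (-s - ξ) = -((ℝ ∙ nSwap)ᗮ.reflection (mk (s + ξ) (ξ - s))) := by
    rw [reflection_nSwap_mk, neg_mk_eq]
    congr 1 <;> ring
  rw [h1, heven, hswap]

/-- **Two-row exponential convexity** (card First lemma; = `TwoRowSwapRP.twoRow_expConvex`, p76142): for `K`
even, swap-invariant and swap-RP, every `ξ` and `ε = ±1`, `T ↦ K(T,-T,0) + ε K(T+ξ, ξ-T, 0)` is a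
positive-definite kernel of `t_a + t_b` on `(0,∞)` — one `2m`-point configuration, rows `t_a(1,-1,0)` and
`t_a(1,-1,0) + ξ(1,1,0)`, coefficients `(c, εc)`; the cross block is symmetric by evenness + swap invariance. -/
theorem twoRow_expConvex {K : E3 → ℝ} (hK : IsMirrorRPKernel nSwap K)
    (heven : ∀ x, K (-x) = K x) (hswap : ∀ x, K ((ℝ ∙ nSwap)ᗮ.reflection x) = K x)
    (ξ ε : ℝ) (hε : ε = 1 ∨ ε = -1) (m : ℕ) (t : Fin m → ℝ) (ht : ∀ a, 0 < t a) (c : Fin m → ℝ) :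
    0 ≤ ∑ a, ∑ b, c a * c b *
      (K (mk (t a + t b) (-(t a + t b))) + ε * K (mk ((t a + t b) + ξ) (ξ - (t a + t b)))) := by
  have hpos : ∀ i : Fin m ⊕ Fin m,
      0 < ⟪Sum.elim (fun a => mk (t a) (-t a)) (fun a => mk (t a + ξ) (ξ - t a)) i, nSwap⟫_ℝ := by
    rintro (a | a)
    · simp only [Sum.elim_inl, inner_mk_nSwap]
      linarith [ht a]
    · simp only [Sum.elim_inr, inner_mk_nSwap]
      linarith [ht a]
  have key := hK.sum_nonneg (Sum.elim (fun a => mk (t a) (-t a)) (fun a => mk (t a + ξ) (ξ - t a)))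
    (Sum.elim c (fun a => ε * c a)) hpos
  rw [Fintype.sum_sum_type] at key
  simp only [Fintype.sum_sum_type, Sum.elim_inl, Sum.elim_inr, twoRow_pt11, twoRow_pt12, twoRow_pt21,
    twoRow_pt22, twoRow_cross_symm heven hswap] at key
  simp only [← Finset.sum_add_distrib] at key
  have key2 := mul_nonneg (show (0:ℝ) ≤ 1 / 2 by norm_num) key
  rw [Finset.mul_sum] at key2
  refine le_of_le_of_eq key2 (Finset.sum_congr rfl fun a _ => ?_)
  rw [Finset.mul_sum]
  refine Finset.sum_congr rfl fun b _ => ?_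
  rcases hε with rfl | rfl <;> ring

/-! ### Continuity and boundedness of the two-row functions -/

theorem mk_eq_smul_add (a b : ℝ) : mk a b = a • mk 1 0 + b • mk 0 1 := by
  ext l
  fin_cases l <;> simp

theorem continuous_mk_diag : Continuous fun T : ℝ => mk T (-T) := by
  have : (fun T : ℝ => mk T (-T)) = fun T => T • mk 1 0 + (-T) • mk 0 1 :=
    funext fun T => mk_eq_smul_add T (-T)
  rw [this]
  fun_prop

theorem continuous_mk_row (ξ : ℝ) : Continuous fun T : ℝ => mk (T + ξ) (ξ - T) := by
  have : (fun T : ℝ => mk (T + ξ) (ξ - T)) = fun T => (T + ξ) • mk 1 0 + (ξ - T) • mk 0 1 :=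
    funext fun T => mk_eq_smul_add (T + ξ) (ξ - T)
  rw [this]
  fun_prop

theorem mk_diag_ne_zero {T : ℝ} (hT : 0 < T) : mk T (-T) ≠ 0 := by
  intro h
  have h0 := congrArg (fun x : E3 => x 0) h
  simp only [mk_apply_zero, PiLp.zero_apply] at h0
  linarith

theorem mk_row_ne_zero (ξ : ℝ) {T : ℝ} (hT : 0 < T) : mk (T + ξ) (ξ - T) ≠ 0 := by
  intro h
  have h0 := congrArg (fun x : E3 => x 0) h
  have h1 := congrArg (fun x : E3 => x 1) h
  simp only [mk_apply_zero, mk_apply_one, PiLp.zero_apply] at h0 h1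
  linarith

theorem continuousOn_twoRow {Δ : ℝ} {K : E3 → ℝ} (h : CruxHyp Δ K) (ξ ε : ℝ) :
    ContinuousOn (fun T : ℝ => K (mk T (-T)) + ε * K (mk (T + ξ) (ξ - T))) (Ioi 0) := by
  have hc1 : ContinuousOn (fun T : ℝ => K (mk T (-T))) (Ioi 0) :=
    h.continuousOn.comp continuous_mk_diag.continuousOn fun T hT => mk_diag_ne_zero hT
  have hc2 : ContinuousOn (fun T : ℝ => K (mk (T + ξ) (ξ - T))) (Ioi 0) :=
    h.continuousOn.comp (continuous_mk_row ξ).continuousOn fun T hT => mk_row_ne_zero ξ hT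
  exact hc1.add (continuousOn_const.mul hc2)

theorem sum_sq_eq_norm_sq (y : E3) : ∑ i, (y i) ^ 2 = ‖y‖ ^ 2 := by
  rw [EuclideanSpace.norm_eq, Real.sq_sqrt (Finset.sum_nonneg fun _ _ => by positivity)]
  simp only [Real.norm_eq_abs, sq_abs]

theorem norm_mk_sq (a b : ℝ) : ‖mk a b‖ ^ 2 = a ^ 2 + b ^ 2 := by
  rw [← sum_sq_eq_norm_sq]
  simp [Fin.sum_univ_three]

theorem le_norm_mk_diag {T : ℝ} (_hT : 0 ≤ T) : T ≤ ‖mk T (-T)‖ := by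
  have h := norm_mk_sq T (-T)
  nlinarith [norm_nonneg (mk T (-T))]

theorem le_norm_mk_row (ξ : ℝ) {T : ℝ} (_hT : 0 ≤ T) : T ≤ ‖mk (T + ξ) (ξ - T)‖ := by
  have h := norm_mk_sq (T + ξ) (ξ - T)
  nlinarith [norm_nonneg (mk (T + ξ) (ξ - T)), sq_nonneg ξ]

/-- `K` is bounded outside every ball: continuity on the (compact) unit sphere + homogeneity of negative
degree (+ `Δ > 0`). -/
theorem cruxHyp_bound {Δ : ℝ} {K : E3 → ℝ} (h : CruxHyp Δ K) {r : ℝ} (hr : 0 < r) :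
    ∃ M : ℝ, ∀ x : E3, r ≤ ‖x‖ → |K x| ≤ M := by
  have hsub : Metric.sphere (0 : E3) 1 ⊆ {0}ᶜ := by
    intro x hx h0
    rw [mem_singleton_iff] at h0
    rw [h0, mem_sphere_zero_iff_norm, norm_zero] at hx
    exact zero_ne_one hx
  obtain ⟨C, hC⟩ := (isCompact_sphere (0 : E3) 1).exists_bound_of_continuousOn (h.continuousOn.mono hsub)
  refine ⟨r ^ (-(2 * Δ)) * C, fun x hx => ?_⟩
  have hxpos : 0 < ‖x‖ := lt_of_lt_of_le hr hx
  set u : E3 := ‖x‖⁻¹ • x with hu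
  have hu1 : ‖u‖ = 1 := by rw [hu, norm_smul, norm_inv, norm_norm, inv_mul_cancel₀ hxpos.ne']
  have hxu : x = ‖x‖ • u := by rw [hu, smul_smul, mul_inv_cancel₀ hxpos.ne', one_smul]
  have hKx : K x = ‖x‖ ^ (-(2 * Δ)) * K u := by
    conv_lhs => rw [hxu]
    exact h.homogeneous _ hxpos u
  have hCu : |K u| ≤ C := by
    have := hC u (mem_sphere_zero_iff_norm.2 hu1)
    simpa [Real.norm_eq_abs] using this
  have hpow : ‖x‖ ^ (-(2 * Δ)) ≤ r ^ (-(2 * Δ)) :=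
    Real.rpow_le_rpow_of_nonpos hr hx (by linarith [h.half_le])
  rw [hKx, abs_mul, abs_of_nonneg (Real.rpow_nonneg hxpos.le _)]
  exact mul_le_mul hpow hCu (abs_nonneg _) (Real.rpow_nonneg hr.le _)

/-- The two-row functions `k₀ + ε g` are bounded on every `[t₀, ∞)` (`ε = ±1`). -/
theorem twoRow_bdd {Δ : ℝ} {K : E3 → ℝ} (h : CruxHyp Δ K) (ξ ε : ℝ) (hε : ε = 1 ∨ ε = -1) {t₀ : ℝ}
    (ht₀ : 0 < t₀) :
    ∃ M : ℝ, ∀ T : ℝ, t₀ ≤ T → |K (mk T (-T)) + ε * K (mk (T + ξ) (ξ - T))| ≤ M := by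
  obtain ⟨M, hM⟩ := cruxHyp_bound h ht₀
  refine ⟨M + M, fun T hT => ?_⟩
  have hT0 : 0 ≤ T := le_trans ht₀.le hT
  have h1 := hM (mk T (-T)) (le_trans hT (le_norm_mk_diag hT0))
  have h2 := hM (mk (T + ξ) (ξ - T)) (le_trans hT (le_norm_mk_row ξ hT0))
  have hε1 : |ε| = 1 := by rcases hε with rfl | rfl <;> simp
  calc |K (mk T (-T)) + ε * K (mk (T + ξ) (ξ - T))|
        ≤ |K (mk T (-T))| + |ε * K (mk (T + ξ) (ξ - T))| := abs_add_le _ _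
    _ = |K (mk T (-T))| + |K (mk (T + ξ) (ξ - T))| := by rw [abs_mul, hε1, one_mul]
    _ ≤ M + M := add_le_add h1 h2

/-- Two-row swap RP packaged: `k₀ + ε g` is a bounded positive-definite function on `((0,∞),+)`. -/
theorem twoRow_boundedExpConvex {Δ : ℝ} {K : E3 → ℝ} (h : CruxHyp Δ K) (ξ ε : ℝ) (hε : ε = 1 ∨ ε = -1) :
    BoundedExpConvex (fun T : ℝ => K (mk T (-T)) + ε * K (mk (T + ξ) (ξ - T))) :=
  ⟨fun m t c ht => twoRow_expConvex (swapRP_of_cruxHyp h) (even_of_cruxHyp h) (swapInv_of_cruxHyp h)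
      ξ ε hε m t ht c,
    fun _ ht₀ => twoRow_bdd h ξ ε hε ht₀⟩

/-! ### The Joukowski dictionary (magic circle), kernel-checked -/

theorem measurable_cCoord (ξ : ℝ) : Measurable (cCoord ξ) := by
  have h0 : Measurable fun ω : Fin 3 → ℝ => ω 0 := measurable_pi_apply 0
  have h1 : Measurable fun ω : Fin 3 → ℝ => ω 1 := measurable_pi_apply 1
  unfold cCoord
  exact ((h1.sub h0).const_mul (2 * ξ)).div (h0.add h1)

theorem measurable_density (Δ : ℝ) :
    Measurable fun ω : Fin 3 → ℝ => ENNReal.ofReal ((ω 0 + ω 1) ^ (-Δ)) :=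
  (((measurable_pi_apply 0).add (measurable_pi_apply 1)).pow_const (-Δ)).ennreal_ofReal

/-- Octant-null ⇒ a.e. all coordinates are positive. -/
theorem ae_pos_of_octant {Φ : Measure (Fin 3 → ℝ)} (h : Φ {ω | ∃ i, ω i ≤ 0} = 0) :
    ∀ᵐ ω ∂Φ, ∀ i, 0 < ω i := by
  have := measure_eq_zero_iff_ae_notMem.1 h
  filter_upwards [this] with ω hω
  simpa using hω

/-- The branch points lie on the slit: `c_ω ∈ [-2, 2]`. -/
theorem cCoord_mem_Icc {ξ : ℝ} (hξ : ξ = 1 ∨ ξ = -1) {ω : Fin 3 → ℝ} (h0 : 0 < ω 0) (h1 : 0 < ω 1) :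
    cCoord ξ ω ∈ Icc (-2 : ℝ) 2 := by
  unfold cCoord
  have hs : 0 < ω 0 + ω 1 := by linarith
  rw [mem_Icc, le_div_iff₀ hs, div_le_iff₀ hs]
  rcases hξ with rfl | rfl <;> constructor <;> nlinarith

/-- The components of the "wrong" anisotropy sign sit on the open sub-slit `(0, 2)`. -/
theorem cCoord_mem_Ioo {ξ : ℝ} (hξ : ξ = 1 ∨ ξ = -1) {ω : Fin 3 → ℝ} (h0 : 0 < ω 0) (h1 : 0 < ω 1)
    (hlt : ξ * (ω 0 - ω 1) < 0) : cCoord ξ ω ∈ Ioo (0 : ℝ) 2 := by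
  unfold cCoord
  have hs : 0 < ω 0 + ω 1 := by linarith
  rw [mem_Ioo, lt_div_iff₀ hs, div_lt_iff₀ hs]
  rcases hξ with rfl | rfl <;> constructor <;> nlinarith

/-- **The magic circle** (card identity (b); x-side form of Disproof `swapSlice_factor`): on the swap plane
the component `ω` of the section at offset sign `ξ = ±1` factors through the Joukowski variable,
`ω₀(T+ξ)² + ω₁(ξ-T)² = (ω₀+ω₁)·T·(T + 1/T - c_ω)` — its complex zeros lie ON the circle `|T| = 1` for every
`ω` at once. -/
theorem magic_circle {ξ : ℝ} (hξ : ξ = 1 ∨ ξ = -1) {ω : Fin 3 → ℝ} (h0 : 0 < ω 0) (h1 : 0 < ω 1)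
    {T : ℝ} (hT : 0 < T) :
    ω 0 * (T + ξ) ^ 2 + ω 1 * (ξ - T) ^ 2 = (ω 0 + ω 1) * T * (T + T⁻¹ - cCoord ξ ω) := by
  unfold cCoord
  have hs : (ω 0 + ω 1) ≠ 0 := by linarith
  have hT' : T ≠ 0 := hT.ne'
  have hξ2 : ξ ^ 2 = 1 := by rcases hξ with rfl | rfl <;> norm_num
  field_simp
  linear_combination (ω 0 + ω 1) * T * hξ2 - (ω 0 + ω 1) * T * hξ2 + (ω 0 + ω 1) * hξ2

theorem two_le_jouk {T : ℝ} (hT : 0 < T) : 2 ≤ T + T⁻¹ := by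
  have hT' : T ≠ 0 := hT.ne'
  have : 0 ≤ (T - 1) ^ 2 / T := by positivity
  calc (2 : ℝ) ≤ 2 + (T - 1) ^ 2 / T := by linarith
    _ = T + T⁻¹ := by field_simp; ring

section Dictionary

variable {Δ ξ : ℝ} {K : E3 → ℝ} {Φ : Measure (Fin 3 → ℝ)}

/-- `(ω₀+ω₁)^(-Δ)` is `Φ`-integrable: it is the polar integrand at `x = e₀ + e₁`. -/
theorem integrable_density [IsFiniteMeasure Φ]
    (hint : ∀ x : E3, x ≠ 0 → Integrable (fun ω => (∑ i, ω i * (x i) ^ 2) ^ (-Δ)) Φ) :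
    Integrable (fun ω : Fin 3 → ℝ => (ω 0 + ω 1) ^ (-Δ)) Φ := by
  have hne : mk 1 1 ≠ 0 := by
    intro h
    have := congrArg (fun x : E3 => x 0) h
    simp at this
  have := hint (mk 1 1) hne
  convert this using 2 with ω
  simp [Fin.sum_univ_three]

/-- The anisotropy measure is finite (face control "for free": `S(2) < ∞`). -/
theorem sliceMeasure_finite [IsFiniteMeasure Φ]
    (hint : ∀ x : E3, x ≠ 0 → Integrable (fun ω => (∑ i, ω i * (x i) ^ 2) ^ (-Δ)) Φ) :
    IsFiniteMeasure (sliceMeasure Δ ξ Φ) := by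
  unfold sliceMeasure
  haveI : IsFiniteMeasure (Φ.withDensity fun ω => ENNReal.ofReal ((ω 0 + ω 1) ^ (-Δ))) :=
    isFiniteMeasure_withDensity_ofReal (integrable_density hint).hasFiniteIntegral
  infer_instance

/-- The anisotropy measure lives on the slit `[-2, 2]`. -/
theorem sliceMeasure_support (hξ : ξ = 1 ∨ ξ = -1) (hoct : Φ {ω | ∃ i, ω i ≤ 0} = 0) :
    sliceMeasure Δ ξ Φ (Icc (-2) 2)ᶜ = 0 := by
  unfold sliceMeasure
  rw [Measure.map_apply (measurable_cCoord ξ) measurableSet_Icc.compl]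
  apply withDensity_absolutelyContinuous
  refine measure_mono_null (fun ω hω => ?_) hoct
  simp only [mem_preimage, mem_compl_iff] at hω
  by_contra hcon
  simp only [mem_setOf_eq, not_exists, not_le] at hcon
  exact hω (cCoord_mem_Icc hξ (hcon 0) (hcon 1))

/-- **The section formula**: `K(T+ξ, ξ-T, 0) = T^(-Δ) · S(T + 1/T)`, `S` the order-`Δ` Stieltjes transform
of the anisotropy measure — the swap-plane section read in the branch-point coordinate. -/
theorem sliceMeasure_section (hξ : ξ = 1 ∨ ξ = -1) (hoct : Φ {ω | ∃ i, ω i ≤ 0} = 0)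
    (hrepr : ∀ x : E3, x ≠ 0 → K x = ∫ ω, (∑ i, ω i * (x i) ^ 2) ^ (-Δ) ∂Φ)
    {T : ℝ} (hT : 0 < T) :
    K (mk (T + ξ) (ξ - T)) = T ^ (-Δ) * joukStieltjes Δ (sliceMeasure Δ ξ Φ) T := by
  rw [hrepr _ (mk_row_ne_zero ξ hT)]
  unfold joukStieltjes sliceMeasure
  have hmeas : Measurable fun c : ℝ => (T + T⁻¹ - c) ^ (-Δ) :=
    (measurable_const.sub measurable_id).pow_const _
  rw [integral_map (measurable_cCoord ξ).aemeasurable hmeas.aestronglyMeasurable]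
  rw [integral_withDensity_eq_integral_toReal_smul (measurable_density Δ)
    (Filter.Eventually.of_forall fun _ => ENNReal.ofReal_lt_top)]
  rw [← integral_const_mul]
  refine integral_congr_ae ?_
  filter_upwards [ae_pos_of_octant hoct] with ω hω
  have h0 := hω 0
  have h1 := hω 1
  simp only [Fin.sum_univ_three, mk_apply_zero, mk_apply_one, mk_apply_two, smul_eq_mul]
  have hs : 0 ≤ ω 0 + ω 1 := by linarith
  have hj : 0 ≤ T + T⁻¹ - cCoord ξ ω := by
    have := (cCoord_mem_Icc hξ h0 h1).2
    linarith [two_le_jouk hT]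
  rw [ENNReal.toReal_ofReal (Real.rpow_nonneg hs _)]
  rw [show ω 0 * (T + ξ) ^ 2 + ω 1 * (ξ - T) ^ 2 + ω 2 * (0:ℝ) ^ 2 =
      (ω 0 + ω 1) * T * (T + T⁻¹ - cCoord ξ ω) by rw [magic_circle hξ h0 h1 hT]; ring]
  rw [Real.mul_rpow (by positivity) hj, Real.mul_rpow hs hT.le]
  ring

/-- **Pull-back of slice rigidity**: no anisotropy mass on `(0,2)` ⇒ `Φ` charges no component with
`ξ(ω₀ - ω₁) < 0` (the density `(ω₀+ω₁)^(-Δ)` is positive on the open octant). -/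
theorem sliceMeasure_pull (hξ : ξ = 1 ∨ ξ = -1) (hoct : Φ {ω | ∃ i, ω i ≤ 0} = 0)
    (h : sliceMeasure Δ ξ Φ (Ioo 0 2) = 0) : Φ {ω | ξ * (ω 0 - ω 1) < 0} = 0 := by
  unfold sliceMeasure at h
  rw [Measure.map_apply (measurable_cCoord ξ) measurableSet_Ioo,
    withDensity_apply _ ((measurable_cCoord ξ) measurableSet_Ioo),
    lintegral_eq_zero_iff (measurable_density Δ)] at h
  have h' : ∀ᵐ ω ∂Φ, ω ∈ cCoord ξ ⁻¹' Ioo 0 2 → ENNReal.ofReal ((ω 0 + ω 1) ^ (-Δ)) = 0 := by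
    rw [← ae_restrict_iff' ((measurable_cCoord ξ) measurableSet_Ioo)]
    exact h
  rw [measure_eq_zero_iff_ae_notMem]
  filter_upwards [ae_pos_of_octant hoct, h'] with ω hω hω'
  intro hmem
  have h0 := hω 0
  have h1 := hω 1
  have hpre : ω ∈ cCoord ξ ⁻¹' Ioo 0 2 := cCoord_mem_Ioo hξ h0 h1 hmem
  have := hω' hpre
  rw [ENNReal.ofReal_eq_zero] at this
  have hpos : 0 < (ω 0 + ω 1) ^ (-Δ) := Real.rpow_pos_of_pos (by linarith) _
  linarith

end Dictionary

/-! ### Permutation symmetry of the polar measure: one pair gives all pairs (Disproof F9(iii)) -/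

theorem measurable_compPerm (σ : Equiv.Perm (Fin 3)) : Measurable fun ω : Fin 3 → ℝ => ω ∘ σ :=
  measurable_pi_lambda _ fun _ => measurable_pi_apply _

theorem measurableSet_ne01 : MeasurableSet {ω : Fin 3 → ℝ | ω 0 ≠ ω 1} := by
  have : {ω : Fin 3 → ℝ | ω 0 ≠ ω 1} = {ω | ω 0 = ω 1}ᶜ := by ext ω; simp
  rw [this]
  exact (measurableSet_eq_fun (measurable_pi_apply 0) (measurable_pi_apply 1)).compl

theorem null12_of_null01 {Φ : Measure (Fin 3 → ℝ)}
    (hsymm : ∀ σ : Equiv.Perm (Fin 3), Φ.map (fun ω => ω ∘ σ) = Φ)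
    (h : Φ {ω | ω 0 ≠ ω 1} = 0) : Φ {ω | ω 1 ≠ ω 2} = 0 := by
  have hσ := hsymm (finRotate 3)
  have e0 : (finRotate 3) 0 = 1 := by decide
  have e1 : (finRotate 3) 1 = 2 := by decide
  have hpre : (fun ω : Fin 3 → ℝ => ω ∘ (finRotate 3)) ⁻¹' {ω | ω 0 ≠ ω 1} = {ω | ω 1 ≠ ω 2} := by
    ext ω
    simp only [mem_preimage, mem_setOf_eq, Function.comp_apply, e0, e1]
  rw [← hpre, ← Measure.map_apply (measurable_compPerm _) measurableSet_ne01, hσ, h]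

theorem ae_diagonal {Φ : Measure (Fin 3 → ℝ)}
    (hsymm : ∀ σ : Equiv.Perm (Fin 3), Φ.map (fun ω => ω ∘ σ) = Φ)
    (h01 : Φ {ω | ω 0 ≠ ω 1} = 0) : ∀ᵐ ω ∂Φ, ω 0 = ω 1 ∧ ω 1 = ω 2 := by
  have h12 := null12_of_null01 hsymm h01
  rw [ae_iff]
  have hsub : {ω : Fin 3 → ℝ | ¬(ω 0 = ω 1 ∧ ω 1 = ω 2)} ⊆ {ω | ω 0 ≠ ω 1} ∪ {ω | ω 1 ≠ ω 2} := by
    intro ω hω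
    simp only [mem_setOf_eq, not_and_or] at hω
    simp only [mem_union, mem_setOf_eq]
    exact hω
  exact measure_mono_null hsub (measure_union_null h01 h12)

/-! ### The round endgame: a diagonal polar measure gives an `O(3)`-invariant kernel -/

/-- If `K x = ∫ (Σ ωᵢxᵢ²)^(-Δ) dΦ` off the origin and `Φ`-a.e. `ω₀ = ω₁ = ω₂`, then `K` is invariant under
every linear isometry (the integrand is `(ω₀‖x‖²)^(-Δ)` a.e., and `‖R x‖ = ‖x‖`; `R 0 = 0`). -/
theorem isometryInvariant_of_diagonal (Δ : ℝ) (K : E3 → ℝ) (Φ : Measure (Fin 3 → ℝ))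
    (hrepr : ∀ x : E3, x ≠ 0 → K x = ∫ ω, (∑ i, ω i * (x i) ^ 2) ^ (-Δ) ∂Φ)
    (hdiag : ∀ᵐ ω ∂Φ, ω 0 = ω 1 ∧ ω 1 = ω 2) (R : E3 ≃ₗᵢ[ℝ] E3) (x : E3) : K (R x) = K x := by
  by_cases hx : x = 0
  · subst hx
    simp
  have hRx : R x ≠ 0 := fun h => hx (by simpa using congrArg R.symm h)
  rw [hrepr _ hRx, hrepr _ hx]
  refine integral_congr_ae ?_
  filter_upwards [hdiag] with ω hω
  obtain ⟨h01, h12⟩ := hω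
  have key : ∀ y : E3, ∑ i, ω i * (y i) ^ 2 = ω 0 * ‖y‖ ^ 2 := by
    intro y
    rw [← sum_sq_eq_norm_sq]
    simp only [Fin.sum_univ_three]
    rw [← h12, ← h01]
    ring
  rw [key (R x), key x, R.norm_map]

/-! ## The registered stubs -/

/-- **S1 · stub_polarForm — polar form of a homogeneous Gaussian scale mixture (DICTIONARY, measure side).**
Under the crux hypotheses (used: `gsm`, `homogeneous`, `0 < Δ` from `half_le`, and the PERMUTATION invariance
`K (x ∘ σ) = K x` contained in `nine` via the swap mirrors `reflection_single_sub_single_apply`; NOT used: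
RP, positivity, continuity) there is a finite measure `Φ` on the open octant `{∀ i, ωᵢ > 0}`, invariant under
the coordinate permutations, with `(Σ ωᵢxᵢ²)^(-Δ)` `Φ`-integrable and `K x = ∫ (Σᵢ ωᵢ xᵢ²)^(-Δ) dΦ(ω)` at every
`x ≠ 0` (`IsPolarGSM`). Why true (Disproof F1/F8(o); refuter 81300ae8 route-review note; card (ii)):
(1) DILATION COVARIANCE: `K (c • x) = c^(-2Δ) K x` says that `(c² • ·)_* ν` and `c^(-2Δ) ν` have the same
Gaussian/Laplace transform `u ↦ ∫ e^{-u·s}` on the OPEN octant `u = (xᵢ²)`; both `e^{-u₀·s}ν`'s are finite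
measures with m.g.f.s finite and equal on a neighbourhood of `0`, hence equal (analytic continuation to the
characteristic function in each variable + `Measure.ext_of_charFun`; 1-D Mathlib tools `eqOn_complexMGF_of_mgf`,
`Measure.ext_of_complexMGF_eq`; the same road is walked for the half-space in
`Cruxes/…/PlanarSpectralCone/DrefuteG4Linearity.measure_ext_of_laplaceFourier`), so
`(λ • ·)_* ν = λ^(-Δ) ν` for `λ > 0`; in particular `ν {0} = 0` (finite by integrability, `2^(-Δ) ≠ 1`) and
the faces `{s ≠ 0, sᵢ = 0}` are `ν`-null (a `Δ`-homogeneous measure on a face is `0` or infinite, and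
`∫ e^{-sᵢ} dν ≥ ν(face)` is finite by integrability at `x = eᵢ`). (2) ONE TONELLI: NO disintegration is
needed — put `Φ(A) := Δ Γ(Δ) ∫_{A ∩ {0 < |s|₁ ≤ 1}} |s|₁^Δ dν(s)`
(`|s|₁ = Σ sᵢ`), a finite measure (`ν{|s|₁ ≤ 1} ≤ e · ∫ e^{-|s|₁} dν < ∞`, integrability at `x = (1,1,1)`);
then with `(s·x²)^(-Δ) = Γ(Δ)⁻¹ ∫₀^∞ r^(Δ-1) e^{-r s·x²} dr` (`integral_rpow_mul_exp_neg_mul_Ioi`), covariance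
applied to the inner `ν`-integral at scale `r`, and Tonelli (`∫_{r ≥ |u|₁} r^(-Δ-1) dr = |u|₁^(-Δ)/Δ`) one gets
`∫ (s·x²)^(-Δ) dΦ(s) = ∫_{u ≠ 0} e^{-u·x²} dν(u) = K x`; integrability = finiteness of this lintegral.
(3) SYMMETRISE: `K` is invariant under coordinate permutations (swap mirrors), so the `S₃`-average
`(1/6) Σ_σ (· ∘ σ)_* Φ` represents the same `K` and is `symm`. No step is in doubt; the Lean work is (1).
Refs: BergChristensenRessel1984 Ch. 4 §4, §6 (Laplace transforms of measures on cones; uniqueness),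
book:berg1984-harmonic-analysis-semigroups (held); SchillingSongVondracek2012 Ch. 1 (Bernstein functions,
not needed). Size: L (multivariate Laplace uniqueness is not in Mathlib). -/
theorem stub_polarForm :
    ∀ (Δ : ℝ) (K : E3 → ℝ), CruxHyp Δ K → ∃ Φ : Measure (Fin 3 → ℝ), IsPolarGSM Δ K Φ := by
  sorry

/-- **S2 · stub_halfPlaneExtension — Bernstein–Widder, holomorphic-extension form (DICTIONARY, analytic side;
this is where reflection positivity is consumed).** A function `f : ℝ → ℝ` that is positive definite on the
additive semigroup `(0,∞)` (`Σ cₐ c_b f(tₐ + t_b) ≥ 0`, `tₐ > 0`) and bounded on every `[t₀,∞)` — and, if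
the prover wants it, continuous on `(0,∞)` — is the restriction to `(0,∞)` of a function holomorphic on the
open right half-plane. Why true: bounded + positive definite on `((0,∞),+)` ⇒ for every `s > 0` there is a
finite positive measure `νₛ` on `[0,∞)` with `f(2s + t) = ∫ e^{-tE} dνₛ(E)` (`t > 0`) — PROVED in the tree,
`Literature.Analysis.OperatorTheory.IsBoundedHalfLinePD.exists_laplace_repr` (GNS + spectral theorem of the
symmetric contraction semigroup; hypotheses = `BoundedExpConvex` field for field, no continuity needed); the
Laplace transform `Fₛ(z) = ∫ e^{-(z-2s)E} dνₛ(E)` of a finite positive measure on `[0,∞)` is holomorphic on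
`Re z > 2s` (differentiation under the integral, `hasDerivAt_integral_of_dominated_loc_of_deriv_le`, dominator
`E e^{-δE} ≤ (eδ)⁻¹`) and equals `f` on `(2s,∞)`; two such `Fₛ, Fₛ'` agree on the ray `(2 max(s,s'), ∞)`, hence
on the half-plane `Re z > 2 max(s,s')` (identity theorem, `AnalyticOnNhd.eqOn_of_preconnected_of_frequently_eq`),
so `F z := F_{Re z/4} z` is a well-defined holomorphic function on `Re z > 0` extending `f`. Classical form:
Widder 1941 *The Laplace Transform* Thm VI.21 (p.170; p.171: continuity suffices, Boas–Widder) =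
BergChristensenRessel1984 Thm 6.5.12 / Ch. 4 §6 (bounded case: one-sided Laplace transforms = completely
monotone functions, Thm 4.6.13). Honest note: without `bdd` the conclusion still holds (two-sided Laplace
transforms, Widder VI.21) but needs the unbounded spectral theorem; `bdd` holds for the line's `f = k₀ ± g`
(`twoRow_bdd`) and is therefore given. Size: M (on top of the tree's `exists_laplace_repr`). -/
theorem stub_halfPlaneExtension :
    ∀ f : ℝ → ℝ, ContinuousOn f (Ioi 0) → BoundedExpConvex f → HasHolomorphicExtension f := by
  sorry

/-- **S3 · stub_sliceNoMass_lt_one — slice rigidity for `0 < Δ < 1`: the one-signed jump (THE LEVER, hardest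
stub).** For a finite positive measure `ρ` on `[-2,2]` put `S(w) := ∫ (w - c)^(-Δ) dρ(c)` (principal branch;
holomorphic on `ℂ ∖ (-∞,2]`, `Im S ≤ 0` on the upper and `≥ 0` on the lower half-plane since EVERY term has
that sign for `0 < Δ ≤ 1`). If `T ↦ S(T + 1/T)` (`= joukStieltjes Δ ρ T` for real `T > 0`, `T ≠ 1`) agrees
there with some `F` holomorphic on `Re T > 0`, then `ρ((0,2)) = 0`. Why true (card move; triage r1-1/2/3
re-derived it end to end): `J(T) = T + 1/T` maps `D₊ = {|T| > 1, Re T > 0}` and `D₋ = {|T| < 1, Re T > 0}`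
each biholomorphically onto `{Re w > 0} ∖ (0,2]`, the outside to `Im w ≷ 0` according to `Im T ≷ 0`; by the
identity theorem (both regions are connected and contain a real interval where `F = S ∘ J`) `F = S ∘ J` on
`D₊ ∪ D₋`. At the arc point `e^{iθ}`, `0 < θ < π/2`, `w₀ = 2cos θ ∈ (0,2)`: continuity of `F` gives
`Im F(e^{iθ}) = lim_{r↓1} Im S(J(re^{iθ})) ≤ 0` and `= lim_{r↑1} Im S(J(re^{iθ})) ≥ 0`, so the limit is `0`;
along `r ↓ 1`, `J(re^{iθ}) → w₀` from the upper half-plane and for `c > w₀`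
`-Im (J(re^{iθ}) - c)^(-Δ) → (c - w₀)^(-Δ) sin(πΔ)` (`Complex.continuousWithinAt_arg_of_re_neg_of_im_zero`),
every term being `≥ 0`; FATOU (`lintegral_liminf_le`) gives
`0 = lim ∫ (-Im …) dρ ≥ sin(πΔ) ∫_{(w₀,2]} (c - w₀)^(-Δ) dρ ≥ sin(πΔ) (2 - w₀)^(-Δ) ρ((w₀,2])`, i.e.
`ρ((w₀,2]) = 0` for every `w₀ ∈ (0,2)` — no a.e. boundary values, no Abel inversion, no conjugation symmetry
needed. (Here `Δ < 1` matters only through `sin(πΔ) > 0`; `Δ = 1` is S4.) This is the x-side twin of Disproof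
`SliceRigidity p` (F3 Steps 3–4, audited F8(iv)–(vi); certified pieces `arcBase_eq`, `jump_positivity`,
p74276): same circle, exponent `Δ` instead of `p = 3/2 - Δ`, an `Im`-sign instead of a monodromy phase. Why it
might fail: only through a mis-statement (e.g. asking for `ρ((0,2])` — true here but not needed — or dropping
`T ≠ 1`); the mathematics was checked by three triagers. Tools: `Complex.cpow` (principal), parametric
holomorphy (`DifferentiableOn` of `w ↦ ∫ (w-c)^(-Δ) dρ` via `hasDerivAt_integral_of_dominated_loc_of_deriv_le`
or `AnalyticOnNhd` of parameter integrals), `IsPreconnected` of `D₊`, `D₋` (images of convex sets under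
`exp`/polar coordinates), Fatou. Refs: Widder 1941 Ch. VIII §7 (Stieltjes transform inversion, the `Δ = 1`
model); Sumner 1949 (generalized Stieltjes transforms, doi:10.1090/S0002-9904-1949-09191-9, background only).
Size: L. -/
theorem stub_sliceNoMass_lt_one : ∀ Δ : ℝ, 0 < Δ → Δ < 1 → SliceNoMass Δ := by
  sorry

/-- **S4 · stub_sliceNoMass_one — slice rigidity at the endpoint `Δ = 1` (Stieltjes–Perron / log-potential
jump).** Same statement at `Δ = 1`, where `S(w) = ∫ dρ(c)/(w - c)` is the Cauchy–Stieltjes transform of `ρ` and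
the termwise sign argument of S3 degenerates (`sin π = 0`: it only shows `ρ` has no atoms in `(0,2)`; triage
r1-2/r1-3 flagged exactly this endpoint). Why true: as in S3, `F = S ∘ J` on `D₊ ∪ D₋`, and continuity of `F`
across the open arc makes the upper and lower boundary values of `S` on `(0,2)` AGREE and be continuous
(`S(w₀ ± i0) = F(e^{iθ(w₀)})`, locally uniformly on compacts of `(0,2)` since `J⁻¹` is continuous up to the
slit from each side); two closings: (a) STIELTJES–PERRON: `-(1/π) Im S(w + iδ) = (P_δ * ρ)(w)` (Poisson
integral), `∫_a^b (P_δ * ρ) → ρ((a,b)) + (ρ{a} + ρ{b})/2`, while the left side `→ 0` uniformly on `[a,b] ⊂ (0,2)`;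
(b) LOG-POTENTIAL JUMP (dominated convergence only, recommended): `L(w) := ∫ log(w - c) dρ(c)` is a local
primitive of `S`; `Im log(w₀ + iδ - c) ∈ (0,π)` increases to `π·𝟙{c > w₀} + (π/2)𝟙{c = w₀}` as `δ ↓ 0`, so
`Im L(w₀ + i0) - Im L(w₀ - i0) = 2π ρ((w₀,2]) + π ρ{w₀}`; if `S` is holomorphic on a disc around `w₀` (it is:
`F ∘ J⁻¹` from both sides glue continuously, Morera/`Complex.differentiableOn_of_continuousOn_…` or directly the
two-sided agreement of `F`), its disc primitive differs from `L` by constants on the two half-discs, so the jump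
is locally constant in `w₀`, forcing `ρ((a,b]) = 0` for `[a,b] ⊂ (0,2)`. The atom at `c = 2` is not claimed
(conclusion is the OPEN slit). x-side twin of Disproof F8(vii) (`atom_pOne_partialFraction`, weak Plemelj).
Tools: `Complex.log`, `Complex.arg` limits at the negative axis (`Complex.arg_ofReal_of_neg`,
`continuousWithinAt_arg_of_re_neg_of_im_zero`, `tendsto_arg_nhdsWithin_im_neg_of_re_neg_of_im_zero`),
dominated convergence (`tendsto_integral_of_dominated_convergence`, bound `π`, `ρ` finite), local primitives of
holomorphic functions on discs (`DifferentiableOn.exists_primitive`-type / `Complex.integral_boundary_rect_eq_zero`).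
Refs: Widder 1941 Ch. VIII Thm 7a (p. 208; Stieltjes–Perron inversion), book:widdernd-laplace-transform
(held). Size: M–L. -/
theorem stub_sliceNoMass_one : SliceNoMass 1 := by
  sorry

/-! ## Assembly of the line (sorry-free) -/

/-- The swap-plane section of `K` at offset sign `ξ`, multiplied by `T^Δ`, is the restriction of a function
holomorphic on the right half-plane: two-row RP (`twoRow_boundedExpConvex`) + S2 applied to `k₀ ± g` +
`g = ((k₀+g) - (k₀-g))/2` + the section formula + `z^Δ` holomorphic on `Re z > 0`. -/
theorem section_holomorphic {Δ : ℝ} {K : E3 → ℝ} (hyp : CruxHyp Δ K) {ξ : ℝ} (hξ : ξ = 1 ∨ ξ = -1)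
    (ρ : Measure ℝ)
    (hsec : ∀ T : ℝ, 0 < T → K (mk (T + ξ) (ξ - T)) = T ^ (-Δ) * joukStieltjes Δ ρ T) :
    ∃ F : ℂ → ℂ, DifferentiableOn ℂ F rightHalfPlane ∧
      ∀ T : ℝ, 0 < T → T ≠ 1 → F (T : ℂ) = ((joukStieltjes Δ ρ T : ℝ) : ℂ) := by
  obtain ⟨Fp, hFp, hFp'⟩ := stub_halfPlaneExtension (fun T => K (mk T (-T)) + 1 * K (mk (T + ξ) (ξ - T)))
    (continuousOn_twoRow hyp ξ 1) (twoRow_boundedExpConvex hyp ξ 1 (Or.inl rfl))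
  obtain ⟨Fm, hFm, hFm'⟩ := stub_halfPlaneExtension (fun T => K (mk T (-T)) + (-1) * K (mk (T + ξ) (ξ - T)))
    (continuousOn_twoRow hyp ξ (-1)) (twoRow_boundedExpConvex hyp ξ (-1) (Or.inr rfl))
  have _ := hξ
  refine ⟨fun z => z ^ (Δ : ℂ) * ((Fp z - Fm z) / 2), ?_, ?_⟩
  · intro z hz
    have hslit : z ∈ Complex.slitPlane := Complex.mem_slitPlane_iff.2 (Or.inl hz)
    have h1 : DifferentiableWithinAt ℂ (fun z : ℂ => z ^ (Δ : ℂ)) rightHalfPlane z :=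
      (differentiableAt_id.cpow (differentiableAt_const _) hslit).differentiableWithinAt
    exact h1.mul (((hFp z hz).sub (hFm z hz)).div_const 2)
  · intro T hT _
    have e1 := hFp' T hT
    have e2 := hFm' T hT
    simp only at e1 e2
    have hKT : ((Fp T - Fm T) / 2 : ℂ) = ((K (mk (T + ξ) (ξ - T)) : ℝ) : ℂ) := by
      rw [e1, e2]
      push_cast
      ring
    have hreal : T ^ Δ * (T ^ (-Δ) * joukStieltjes Δ ρ T) = joukStieltjes Δ ρ T := by
      rw [← mul_assoc, Real.rpow_neg hT.le, mul_inv_cancel₀ (Real.rpow_pos_of_pos hT Δ).ne', one_mul]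
    simp only
    rw [hKT, hsec T hT, ← Complex.ofReal_cpow hT.le, ← Complex.ofReal_mul, hreal]

/-- One pair: `Φ` charges no `ω` with `ω₀ ≠ ω₁` (both offset signs `ξ = ±1`). -/
theorem pair01_null {Δ : ℝ} {K : E3 → ℝ} {Φ : Measure (Fin 3 → ℝ)} (hyp : CruxHyp Δ K)
    (hΦ : IsPolarGSM Δ K Φ) (hslice : SliceNoMass Δ) : Φ {ω | ω 0 ≠ ω 1} = 0 := by
  haveI := hΦ.finite
  have key : ∀ ξ : ℝ, (ξ = 1 ∨ ξ = -1) → Φ {ω | ξ * (ω 0 - ω 1) < 0} = 0 := by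
    intro ξ hξ
    refine sliceMeasure_pull hξ hΦ.octant (hslice _ (sliceMeasure_finite hΦ.integrable)
      (sliceMeasure_support hξ hΦ.octant) ?_)
    exact section_holomorphic hyp hξ _ (fun T hT => sliceMeasure_section hξ hΦ.octant hΦ.repr hT)
  have h1 := key 1 (Or.inl rfl)
  have h2 := key (-1) (Or.inr rfl)
  have hsub : {ω : Fin 3 → ℝ | ω 0 ≠ ω 1} ⊆
      {ω | (1 : ℝ) * (ω 0 - ω 1) < 0} ∪ {ω | (-1 : ℝ) * (ω 0 - ω 1) < 0} := by
    intro ω hω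
    simp only [mem_setOf_eq] at hω
    simp only [mem_union, mem_setOf_eq]
    rcases lt_or_gt_of_ne hω with h | h
    · left; linarith
    · right; linarith
  exact measure_mono_null hsub (measure_union_null h1 h2)

/-- **`GSMRigidity_of`** — the stubs prove the crux BY NAME:
`stub_polarForm` → (two-row RP + `stub_halfPlaneExtension` + the kernel-checked Joukowski dictionary) →
`stub_sliceNoMass_lt_one` (`Δ < 1`) | `stub_sliceNoMass_one` (`Δ = 1`) → (symmetry transport + round
endgame, kernel-checked). -/
theorem GSMRigidity_of :
    Summit.CriticalPhenomena.Ising3DConformalLimit.Theses.GaussianScaleMixture.GSMRigidity := by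
  intro Δ K h1 h2 hc hpos hhom hnine hgsm R x
  have hyp : CruxHyp Δ K := ⟨h1, h2, hc, hpos, hhom, hnine, hgsm⟩
  have hΔ : 0 < Δ := by linarith
  obtain ⟨Φ, hΦ⟩ := stub_polarForm Δ K hyp
  have hslice : SliceNoMass Δ := by
    rcases h2.lt_or_eq with hlt | heq
    · exact stub_sliceNoMass_lt_one Δ hΔ hlt
    · rw [heq]; exact stub_sliceNoMass_one
  have h01 : Φ {ω | ω 0 ≠ ω 1} = 0 := pair01_null hyp hΦ hslice
  exact isometryInvariant_of_diagonal Δ K Φ hΦ.repr (ae_diagonal hΦ.symm h01) R x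

/-- **Milestone inside the line: the open window `1/2 ≤ Δ < 1` (contains the Ising value `Δ_σ ≈ 0.518`)
needs S1, S2, S3 only** — the endpoint stub S4 serves `Δ = 1` alone. -/
theorem gsmRigidity_of_lt_one {Δ : ℝ} {K : E3 → ℝ} (hyp : CruxHyp Δ K) (hlt : Δ < 1)
    (R : E3 ≃ₗᵢ[ℝ] E3) (x : E3) : K (R x) = K x := by
  have hΔ : 0 < Δ := by linarith [hyp.half_le]
  obtain ⟨Φ, hΦ⟩ := stub_polarForm Δ K hyp
  exact isometryInvariant_of_diagonal Δ K Φ hΦ.repr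
    (ae_diagonal hΦ.symm (pair01_null hyp hΦ (stub_sliceNoMass_lt_one Δ hΔ hlt))) R x

end Summit.CriticalPhenomena.Ising3DConformalLimit.Cruxes.GSMRigidity.TiltedLightconeJumpPositivity

end
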